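import Literature.Barriers.CriticalPhenomena.GaussianDominationRouteSladeLemma
import HarnessLib

/-!
# Towards `HaraSlade1990_infraredBound_holds`, V: the function `a = 2dp (D + D ⋆ Π)` of the
# `f₃`-improvement, its cosine transform `â = 2dp D̂ (1 + Π̂)`, and the bounds (8.4.19)–(8.4.23)

Sibling proof file of `GaussianDominationRoute{Bootstrap,…,SladeLemma}.lean` (barrier catalogue
`Literature/Barriers/CriticalPhenomena/`). Heydenreich–van der Hofstad's improvement of `f₃`
(Lemma 8.12) writes `τ̂_p = b̂/(1 - â)` with `b̂ = 1 + Π̂_p`, `â = 2dpD̂[1 + Π̂_p]` ((8.4.15)) and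
applies Lemma 8.2 to `Â = 1/(1 - â)`; this needs `â` to be the transform of a summable FUNCTION
`a : ℤ^d → ℝ`, namely (p. 108) `a = 2dp (D + D ⋆ Π_p)` with `D(x) = 𝟙{|x| = 1}/(2d)`, together
with the bound `|â|(0) - |â|(k) = 2dp Σ_x [1 - cos(k·x)] |D(x) + (D⋆Π_p)(x)| ≤ …[1 - D̂(k)]`.

## Contents (namespace `Literature.Barriers.CriticalPhenomena`)

* `hvdhA q Π x = q (2d)⁻¹ Σⱼ [𝟙{x = eⱼ} + 𝟙{x = -eⱼ} + Π(x - eⱼ) + Π(x + eⱼ)]` — the function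
  `q (D + D ⋆ Π)` written with the `2d` unit vectors `±eⱼ` (so that all inner sums are finite;
  `D` is the `srwStep` of `GaussianDominationRouteNoble.lean`);
* `summable_hvdhA`; `cosFT_hvdhA` — **`â(m) = q D̂(m) [1 + Π̂(m)]` for symmetric summable `Π`**
  (the convolution theorem in this finite instance: `Σ_x cos(m·x) Π(x ∓ eⱼ) = cos(mⱼ) Π̂(m)`, the
  sine part vanishing by symmetry, `tsum_sin_kdot_mul_eq_zero`);
* `tsum_one_sub_cos_mul_abs_hvdhA_le` — **`Σ_x [1 - cos(m·x)] |a(x)| ≤ q ([1 - D̂(m)] + 2B_Π(m) + 2A_Π [1 - D̂(m)])`**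
  with `A_Π = Σ|Π|`, `B_Π(m) = Σ_x [1 - cos(m·x)]|Π(x)|` (p. 108, via
  `1 - cos(α + β) ≤ 2[1 - cos α] + 2[1 - cos β]`, `one_sub_cos_add_le`);
* the difference bounds (8.4.20)–(8.4.23): `|Π̂(l ± k) - Π̂(l)| ≤ B_Π(k) + 2√(B_Π(l)) √(B_Π(k))`
  (`abs_cosFT_add_sub_le`, `abs_cosFT_sub_sub_le`) and
  `|D̂(l ± k) - D̂(l)| ≤ [1 - D̂(k)] + 2√(1 - D̂(l)) √(1 - D̂(k))` (`abs_Dhat_add_sub_le`,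
  `abs_Dhat_sub_sub_le`).

## References

* M. Heydenreich, R. van der Hofstad, *Progress in High-Dimensional Percolation and Random
  Graphs* (Springer 2017): (8.4.15), (8.4.19)–(8.4.23), p. 108 (`|â|(0) - |â|(k)` for
  `a = 2dp(D + D⋆Π_p)`), (1.2.18) (`D`).
-/

noncomputable section

namespace Literature.Barriers.CriticalPhenomena

open MeasureTheory Filter Topology Literature.Probability.LatticeModels Literature.Probability.Percolation
open scoped BigOperators

variable {d : ℕ}

/-! ### Trigonometric and lattice-sum preliminaries -/

/-- `1 - cos(α + β) ≤ 2[1 - cos α] + 2[1 - cos β]`. [folklore] -/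
theorem one_sub_cos_add_le (α β : ℝ) :
    1 - Real.cos (α + β) ≤ 2 * (1 - Real.cos α) + 2 * (1 - Real.cos β) := by
  rw [Real.cos_add]
  nlinarith [sq_nonneg (Real.sin α - Real.sin β), Real.sin_sq_add_cos_sq α, Real.sin_sq_add_cos_sq β,
    mul_nonneg (sub_nonneg.2 (Real.cos_le_one α)) (sub_nonneg.2 (Real.cos_le_one β)),
    sq_nonneg (Real.cos α - Real.cos β), Real.cos_le_one α, Real.cos_le_one β,
    Real.neg_one_le_cos α, Real.neg_one_le_cos β]

/-- `k · eⱼ = kⱼ` for the unit vector `eⱼ = Pi.single j 1 ∈ ℤ^d`. [folklore] -/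
theorem kdot_single_one (k : Fin d → ℝ) (j : Fin d) : kdot k (Pi.single j (1 : ℤ)) = k j := by
  classical
  simp only [kdot]
  rw [Finset.sum_eq_single j]
  · simp
  · intro i _ hij
    simp [hij]
  · intro h; exact absurd (Finset.mem_univ j) h

/-- For symmetric `Π` (`Π(-x) = Π(x)`) the sine transform vanishes: `Σ_x sin(m·x) Π(x) = 0`.
[cite: HeydenreichVanDerHofstad2017, p. 74 (spatial symmetry of Π_p)] -/
theorem tsum_sin_kdot_mul_eq_zero {P : Site d → ℝ} (hP : ∀ x, P (-x) = P x) (m : Fin d → ℝ) :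
    ∑' x, Real.sin (kdot m x) * P x = 0 := by
  set f : Site d → ℝ := fun x => Real.sin (kdot m x) * P x with hf
  have h1 : ∑' x, f x = ∑' x, f (-x) := ((Equiv.neg (Site d)).tsum_eq f).symm
  have h2 : ∀ x, f (-x) = -f x := fun x => by
    simp only [hf, kdot_neg, Real.sin_neg, hP, neg_mul]
  simp_rw [h2, tsum_neg] at h1
  show ∑' x, f x = 0
  linarith

/-- Shifting the summation variable: `Σ_x F(x) Π(x - e) = Σ_y F(y + e) Π(y)`. [folklore] -/
theorem tsum_mul_shift_sub (F : Site d → ℝ) (P : Site d → ℝ) (e : Site d) :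
    ∑' x, F x * P (x - e) = ∑' y, F (y + e) * P y := by
  rw [← (Equiv.addRight e).tsum_eq]
  refine tsum_congr fun y => ?_
  simp

/-- Shifting the summation variable: `Σ_x F(x) Π(x + e) = Σ_y F(y - e) Π(y)`. [folklore] -/
theorem tsum_mul_shift_add (F : Site d → ℝ) (P : Site d → ℝ) (e : Site d) :
    ∑' x, F x * P (x + e) = ∑' y, F (y - e) * P y := by
  rw [← (Equiv.subRight e).tsum_eq]
  refine tsum_congr fun y => ?_
  simp

/-! ### The function `a = q (D + D ⋆ Π)` -/

/-- **`a = q (D + D ⋆ Π)`** with `D(x) = 𝟙{|x| = 1}/(2d)` the nearest-neighbour step distribution,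
written with the unit vectors `±eⱼ`:
`a(x) = q (2d)⁻¹ Σⱼ [𝟙{x = eⱼ} + 𝟙{x = -eⱼ} + Π(x - eⱼ) + Π(x + eⱼ)]` (for percolation `q = 2dp` and
`Π = Π_p`; then `â = 2dp D̂ [1 + Π̂_p]` is the `â` of (8.4.15), `cosFT_hvdhA`).
[cite: HeydenreichVanDerHofstad2017, (8.4.15) and p. 108 (a = 2dp(D + D ⋆ Π_p))] -/
def hvdhA (q : ℝ) (P : Site d → ℝ) (x : Site d) : ℝ :=
  q * ((1 / (2 * d)) * ∑ j : Fin d,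
    ((if x = Pi.single j 1 then 1 else 0) + (if x = -Pi.single j 1 then 1 else 0) +
      P (x - Pi.single j 1) + P (x + Pi.single j 1)))

/-- Unfolding lemma. [folklore] -/
theorem hvdhA_def (q : ℝ) (P : Site d → ℝ) (x : Site d) :
    hvdhA q P x = q * ((1 / (2 * d)) * ∑ j : Fin d,
      ((if x = Pi.single j 1 then 1 else 0) + (if x = -Pi.single j 1 then 1 else 0) +
        P (x - Pi.single j 1) + P (x + Pi.single j 1))) := rfl

section A

variable {P : Site d → ℝ} (hPs : Summable P)
include hPs

/-- The four summands of `a` are summable. [folklore] -/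
theorem summable_hvdhA_summand (j : Fin d) :
    Summable fun x : Site d =>
      (if x = Pi.single j 1 then (1 : ℝ) else 0) + (if x = -Pi.single j 1 then 1 else 0) +
        P (x - Pi.single j 1) + P (x + Pi.single j 1) := by
  refine ((Summable.add ?_ ?_).add ?_).add ?_
  · exact (hasSum_ite_eq _ _).summable
  · exact (hasSum_ite_eq _ _).summable
  · exact hPs.comp_injective sub_left_injective
  · exact hPs.comp_injective (add_left_injective _)

/-- `a` is summable. [folklore] -/
theorem summable_hvdhA (q : ℝ) : Summable (hvdhA q P) := by
  unfold hvdhA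
  exact ((summable_sum fun j _ => summable_hvdhA_summand hPs j).mul_left _).mul_left _

omit hPs in
/-- A bounded multiple of a point mass: `Σ_x F(x) 𝟙{x = e} = F(e)`. [folklore] -/
theorem tsum_mul_ite_eq (F : Site d → ℝ) (e : Site d) :
    ∑' x : Site d, F x * (if x = e then (1 : ℝ) else 0) = F e := by
  rw [show (fun x : Site d => F x * (if x = e then (1 : ℝ) else 0)) =
    fun x => if x = e then F x else 0 from funext fun x => by split_ifs <;> simp, tsum_ite_eq]

/-- `x ↦ F(x) Π(x - e)` is summable for bounded `F`. [folklore] -/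
theorem summable_mul_shift_sub {F : Site d → ℝ} {C : ℝ} (hF : ∀ x, |F x| ≤ C) (e : Site d) :
    Summable fun x : Site d => F x * P (x - e) :=
  Summable.of_norm_bounded ((hPs.comp_injective (sub_left_injective (b := e))).norm.mul_left C) fun x => by
    rw [Real.norm_eq_abs, abs_mul, Real.norm_eq_abs]
    exact mul_le_mul_of_nonneg_right (hF x) (abs_nonneg _)

/-- `x ↦ F(x) Π(x + e)` is summable for bounded `F`. [folklore] -/
theorem summable_mul_shift_add {F : Site d → ℝ} {C : ℝ} (hF : ∀ x, |F x| ≤ C) (e : Site d) :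
    Summable fun x : Site d => F x * P (x + e) :=
  Summable.of_norm_bounded ((hPs.comp_injective (add_left_injective e)).norm.mul_left C) fun x => by
    rw [Real.norm_eq_abs, abs_mul, Real.norm_eq_abs]
    exact mul_le_mul_of_nonneg_right (hF x) (abs_nonneg _)

/-- **`â(m) = q D̂(m) [1 + Π̂(m)]`** for symmetric summable `Π` (`d ≥ 1`).
[cite: HeydenreichVanDerHofstad2017, (8.4.15) (â = 2dp D̂ [1 + Π̂_p])] -/
theorem cosFT_hvdhA [NeZero d] (hP : ∀ x, P (-x) = P x) (q : ℝ) (m : Fin d → ℝ) :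
    cosFT (hvdhA q P) m = q * Dhat d m * (1 + cosFT P m) := by
  have hd : (d : ℝ) ≠ 0 := by exact_mod_cast NeZero.ne d
  have hcos1 : ∀ x : Site d, |Real.cos (kdot m x)| ≤ 1 := fun x => Real.abs_cos_le_one _
  have hsin1 : ∀ x : Site d, |Real.sin (kdot m x)| ≤ 1 := fun x => Real.abs_sin_le_one _
  have hcs : Summable fun x => Real.cos (kdot m x) * P x := summable_cos_kdot_mul hPs m
  have hss : Summable fun x => Real.sin (kdot m x) * P x :=
    (summable_mul_of_abs_le hPs 1 fun x => Real.abs_sin_le_one (kdot m x)).congr fun x => by ring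
  -- the four elementary transforms
  have h1 : ∀ j : Fin d, ∑' x : Site d, Real.cos (kdot m x) * (if x = Pi.single j 1 then (1 : ℝ) else 0)
      = Real.cos (m j) := fun j => by rw [tsum_mul_ite_eq, kdot_single_one]
  have h2 : ∀ j : Fin d, ∑' x : Site d, Real.cos (kdot m x) * (if x = -Pi.single j 1 then (1 : ℝ) else 0)
      = Real.cos (m j) := fun j => by rw [tsum_mul_ite_eq, kdot_neg, Real.cos_neg, kdot_single_one]
  have h3 : ∀ j : Fin d, ∑' x : Site d, Real.cos (kdot m x) * P (x - Pi.single j 1)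
      = Real.cos (m j) * cosFT P m := fun j => by
    rw [tsum_mul_shift_sub]
    have e : (fun y : Site d => Real.cos (kdot m (y + Pi.single j 1)) * P y) =
        fun y => Real.cos (m j) * (Real.cos (kdot m y) * P y) -
          Real.sin (m j) * (Real.sin (kdot m y) * P y) := by
      funext y
      rw [kdot_add, kdot_single_one, Real.cos_add]
      ring
    rw [e, (hcs.mul_left _).tsum_sub (hss.mul_left _), tsum_mul_left, tsum_mul_left,
      tsum_sin_kdot_mul_eq_zero hP, mul_zero, sub_zero, cosFT]
  have h4 : ∀ j : Fin d, ∑' x : Site d, Real.cos (kdot m x) * P (x + Pi.single j 1)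
      = Real.cos (m j) * cosFT P m := fun j => by
    rw [tsum_mul_shift_add]
    have e : (fun y : Site d => Real.cos (kdot m (y - Pi.single j 1)) * P y) =
        fun y => Real.cos (m j) * (Real.cos (kdot m y) * P y) +
          Real.sin (m j) * (Real.sin (kdot m y) * P y) := by
      funext y
      rw [sub_eq_add_neg y, kdot_add, kdot_neg, kdot_single_one, Real.cos_add, Real.cos_neg,
        Real.sin_neg]
      ring
    rw [e, (hcs.mul_left _).tsum_add (hss.mul_left _), tsum_mul_left, tsum_mul_left,
      tsum_sin_kdot_mul_eq_zero hP, mul_zero, add_zero, cosFT]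
  -- summability of the pieces, with the cosine weight
  have hA : ∀ j : Fin d, Summable fun x : Site d =>
      Real.cos (kdot m x) * (if x = Pi.single j 1 then (1 : ℝ) else 0) := fun j =>
    Summable.of_norm_bounded (hasSum_ite_eq (Pi.single j (1 : ℤ)) (1 : ℝ)).summable.norm fun x => by
      rw [Real.norm_eq_abs, abs_mul, Real.norm_eq_abs]
      exact mul_le_of_le_one_left (abs_nonneg _) (Real.abs_cos_le_one _)
  have hB : ∀ j : Fin d, Summable fun x : Site d =>
      Real.cos (kdot m x) * (if x = -Pi.single j 1 then (1 : ℝ) else 0) := fun j =>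
    Summable.of_norm_bounded (hasSum_ite_eq (-Pi.single j (1 : ℤ)) (1 : ℝ)).summable.norm fun x => by
      rw [Real.norm_eq_abs, abs_mul, Real.norm_eq_abs]
      exact mul_le_of_le_one_left (abs_nonneg _) (Real.abs_cos_le_one _)
  have hC : ∀ j : Fin d, Summable fun x : Site d => Real.cos (kdot m x) * P (x - Pi.single j 1) :=
    fun j => summable_mul_shift_sub hPs hcos1 _
  have hD : ∀ j : Fin d, Summable fun x : Site d => Real.cos (kdot m x) * P (x + Pi.single j 1) :=
    fun j => summable_mul_shift_add hPs hcos1 _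
  have hsum : ∀ j : Fin d, Summable fun x : Site d => Real.cos (kdot m x) *
      ((if x = Pi.single j 1 then (1 : ℝ) else 0) + (if x = -Pi.single j 1 then 1 else 0) +
        P (x - Pi.single j 1) + P (x + Pi.single j 1)) := fun j =>
    ((((hA j).add (hB j)).add (hC j)).add (hD j)).congr fun x => by ring
  have hj : ∀ j : Fin d, ∑' x : Site d, Real.cos (kdot m x) *
      ((if x = Pi.single j 1 then (1 : ℝ) else 0) + (if x = -Pi.single j 1 then 1 else 0) +
        P (x - Pi.single j 1) + P (x + Pi.single j 1)) = 2 * Real.cos (m j) * (1 + cosFT P m) := by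
    intro j
    have e : (fun x : Site d => Real.cos (kdot m x) *
        ((if x = Pi.single j 1 then (1 : ℝ) else 0) + (if x = -Pi.single j 1 then 1 else 0) +
          P (x - Pi.single j 1) + P (x + Pi.single j 1))) =
        fun x => Real.cos (kdot m x) * (if x = Pi.single j 1 then (1 : ℝ) else 0) +
          Real.cos (kdot m x) * (if x = -Pi.single j 1 then (1 : ℝ) else 0) +
          Real.cos (kdot m x) * P (x - Pi.single j 1) + Real.cos (kdot m x) * P (x + Pi.single j 1) :=
      funext fun x => by ring
    rw [e, (((hA j).add (hB j)).add (hC j)).tsum_add (hD j), ((hA j).add (hB j)).tsum_add (hC j),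
      (hA j).tsum_add (hB j), h1 j, h2 j, h3 j, h4 j]
    ring
  -- assemble
  unfold cosFT hvdhA
  calc ∑' x : Site d, Real.cos (kdot m x) * (q * (1 / (2 * d) * ∑ j : Fin d,
        ((if x = Pi.single j 1 then (1 : ℝ) else 0) + (if x = -Pi.single j 1 then 1 else 0) +
          P (x - Pi.single j 1) + P (x + Pi.single j 1))))
      = q * (1 / (2 * d)) * ∑' x : Site d, ∑ j : Fin d, Real.cos (kdot m x) *
        ((if x = Pi.single j 1 then (1 : ℝ) else 0) + (if x = -Pi.single j 1 then 1 else 0) +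
          P (x - Pi.single j 1) + P (x + Pi.single j 1)) := by
        rw [← tsum_mul_left]
        refine tsum_congr fun x => ?_
        simp only [Finset.mul_sum]
        refine Finset.sum_congr rfl fun j _ => ?_
        ring
    _ = q * (1 / (2 * d)) * ∑ j : Fin d, ∑' x : Site d, Real.cos (kdot m x) *
        ((if x = Pi.single j 1 then (1 : ℝ) else 0) + (if x = -Pi.single j 1 then 1 else 0) +
          P (x - Pi.single j 1) + P (x + Pi.single j 1)) := by
        rw [Summable.tsum_finsetSum fun j _ => hsum j]
    _ = q * (1 / (2 * d)) * ∑ j : Fin d, (2 * Real.cos (m j) * (1 + ∑' x, Real.cos (kdot m x) * P x)) := by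
        congr 1
        exact Finset.sum_congr rfl fun j _ => hj j
    _ = q * Dhat d m * (1 + ∑' x, Real.cos (kdot m x) * P x) := by
        have e : ∑ j : Fin d, 2 * Real.cos (m j) * (1 + ∑' x, Real.cos (kdot m x) * P x) =
            2 * (1 + ∑' x, Real.cos (kdot m x) * P x) * ∑ j : Fin d, Real.cos (m j) := by
          rw [Finset.mul_sum]
          exact Finset.sum_congr rfl fun j _ => by ring
        rw [e, Dhat]
        field_simp

/-- **`Σ_x [1 - cos(m·x)] |a(x)| ≤ q ([1 - D̂(m)] + 2 B_Π(m) + 2 A_Π [1 - D̂(m)])`** for `q ≥ 0`,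
`d ≥ 1`, where `A_Π = Σ|Π|` and `B_Π(m) = Σ_x [1 - cos(m·x)] |Π(x)|`: the shifted sums obey
`Σ_x [1 - cos(m·x)] |Π(x ∓ eⱼ)| ≤ 2 B_Π(m) + 2 [1 - cos(mⱼ)] A_Π` by `one_sub_cos_add_le`.
[cite: HeydenreichVanDerHofstad2017, p. 108 (|â|(0) - |â|(k) ≤ 2dp[1 - D̂(k)] + Σ[1 - cos(k·x)]|(D⋆Π_p)(x)|)] -/
theorem tsum_one_sub_cos_mul_abs_hvdhA_le [NeZero d] {q : ℝ} (hq : 0 ≤ q) (m : Fin d → ℝ) :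
    ∑' x, (1 - Real.cos (kdot m x)) * |hvdhA q P x| ≤
      q * ((1 - Dhat d m) + 2 * (∑' x, (1 - Real.cos (kdot m x)) * |P x|) +
        2 * (∑' x, |P x|) * (1 - Dhat d m)) := by
  have hd : (0 : ℝ) < d := by exact_mod_cast Nat.pos_of_ne_zero (NeZero.ne d)
  set B := ∑' x, (1 - Real.cos (kdot m x)) * |P x| with hB
  set A := ∑' x, |P x| with hA
  have hPa : Summable fun x => |P x| := hPs.abs
  have hc0 : ∀ x : Site d, 0 ≤ 1 - Real.cos (kdot m x) := fun x => sub_nonneg.2 (Real.cos_le_one _)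
  have hc2 : ∀ x : Site d, |1 - Real.cos (kdot m x)| ≤ 2 := fun x => by
    rw [abs_of_nonneg (hc0 x)]; linarith [Real.neg_one_le_cos (kdot m x)]
  have hBs := summable_one_sub_cos_mul_abs hPs m
  -- the pieces `g_j(x) = 𝟙 + 𝟙 + |Π(x-eⱼ)| + |Π(x+eⱼ)|` and the pointwise bound `|a| ≤ q(2d)⁻¹ Σⱼ gⱼ`
  set g : Fin d → Site d → ℝ := fun j x =>
    (if x = Pi.single j 1 then (1 : ℝ) else 0) + (if x = -Pi.single j 1 then 1 else 0) +
      |P (x - Pi.single j 1)| + |P (x + Pi.single j 1)| with hg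
  have hg0 : ∀ j x, 0 ≤ g j x := fun j x => by
    simp only [hg]
    have h1 : (0 : ℝ) ≤ (if x = Pi.single j 1 then (1 : ℝ) else 0) := by split_ifs <;> norm_num
    have h2 : (0 : ℝ) ≤ (if x = -Pi.single j 1 then (1 : ℝ) else 0) := by split_ifs <;> norm_num
    positivity
  have habs : ∀ x, |hvdhA q P x| ≤ q * ((1 / (2 * d)) * ∑ j, g j x) := by
    intro x
    rw [hvdhA, abs_mul, abs_of_nonneg hq, abs_mul, abs_of_nonneg (by positivity : (0:ℝ) ≤ 1 / (2 * d))]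
    refine mul_le_mul_of_nonneg_left (mul_le_mul_of_nonneg_left ?_ (by positivity)) hq
    refine (Finset.abs_sum_le_sum_abs _ _).trans (Finset.sum_le_sum fun j _ => ?_)
    simp only [hg]
    have h1 : (0 : ℝ) ≤ (if x = Pi.single j 1 then (1 : ℝ) else 0) := by split_ifs <;> norm_num
    have h2 : (0 : ℝ) ≤ (if x = -Pi.single j 1 then (1 : ℝ) else 0) := by split_ifs <;> norm_num
    calc |(if x = Pi.single j 1 then (1 : ℝ) else 0) + (if x = -Pi.single j 1 then 1 else 0) +
          P (x - Pi.single j 1) + P (x + Pi.single j 1)|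
        ≤ |(if x = Pi.single j 1 then (1 : ℝ) else 0) + (if x = -Pi.single j 1 then 1 else 0) +
          P (x - Pi.single j 1)| + |P (x + Pi.single j 1)| := abs_add_le _ _
      _ ≤ |(if x = Pi.single j 1 then (1 : ℝ) else 0) + (if x = -Pi.single j 1 then 1 else 0)| +
          |P (x - Pi.single j 1)| + |P (x + Pi.single j 1)| := by
          linarith [abs_add_le ((if x = Pi.single j 1 then (1 : ℝ) else 0) +
            (if x = -Pi.single j 1 then 1 else 0)) (P (x - Pi.single j 1))]
      _ = _ := by rw [abs_of_nonneg (by positivity)]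
  -- summability of `w · g_j`
  have hwg : ∀ j, Summable fun x : Site d => (1 - Real.cos (kdot m x)) * g j x := by
    intro j
    simp only [hg]
    have s1 : Summable fun x : Site d => (1 - Real.cos (kdot m x)) * (if x = Pi.single j 1 then (1 : ℝ) else 0) :=
      summable_of_ne_finset_zero (s := {Pi.single j 1}) fun x hx => by
        rw [Finset.mem_singleton] at hx; simp [hx]
    have s2 : Summable fun x : Site d => (1 - Real.cos (kdot m x)) * (if x = -Pi.single j 1 then (1 : ℝ) else 0) :=
      summable_of_ne_finset_zero (s := {-Pi.single j 1}) fun x hx => by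
        rw [Finset.mem_singleton] at hx; simp [hx]
    have s3 : Summable fun x : Site d => (1 - Real.cos (kdot m x)) * |P (x - Pi.single j 1)| :=
      summable_mul_shift_sub (P := fun x => |P x|) hPa hc2 _
    have s4 : Summable fun x : Site d => (1 - Real.cos (kdot m x)) * |P (x + Pi.single j 1)| :=
      summable_mul_shift_add (P := fun x => |P x|) hPa hc2 _
    exact (((s1.add s2).add s3).add s4).congr fun x => by ring
  -- the value/bound of `Σ_x w(x) g_j(x)`
  have hshift₁ : ∀ j : Fin d, ∑' x : Site d, (1 - Real.cos (kdot m x)) * |P (x - Pi.single j 1)| ≤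
      2 * B + 2 * (1 - Real.cos (m j)) * A := fun j => by
    rw [tsum_mul_shift_sub (fun x => 1 - Real.cos (kdot m x)) (fun x => |P x|)]
    have hle : ∀ y : Site d, (1 - Real.cos (kdot m (y + Pi.single j 1))) * |P y| ≤
        2 * ((1 - Real.cos (kdot m y)) * |P y|) + 2 * (1 - Real.cos (m j)) * |P y| := fun y => by
      rw [kdot_add, kdot_single_one]
      nlinarith [one_sub_cos_add_le (kdot m y) (m j), abs_nonneg (P y)]
    have hsl : Summable fun y : Site d => (1 - Real.cos (kdot m (y + Pi.single j 1))) * |P y| :=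
      Summable.of_norm_bounded (hPa.mul_left 2) fun y => by
        rw [Real.norm_eq_abs, abs_mul, abs_abs, abs_of_nonneg (sub_nonneg.2 (Real.cos_le_one _))]
        refine mul_le_mul_of_nonneg_right ?_ (abs_nonneg _)
        linarith [Real.neg_one_le_cos (kdot m (y + Pi.single j 1))]
    calc ∑' y : Site d, (1 - Real.cos (kdot m (y + Pi.single j 1))) * |P y|
        ≤ ∑' y : Site d, (2 * ((1 - Real.cos (kdot m y)) * |P y|) + 2 * (1 - Real.cos (m j)) * |P y|) :=
          Summable.tsum_le_tsum hle hsl ((hBs.mul_left 2).add (hPa.mul_left _))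
      _ = 2 * B + 2 * (1 - Real.cos (m j)) * A := by
          rw [(hBs.mul_left 2).tsum_add (hPa.mul_left _), tsum_mul_left, tsum_mul_left]
  have hshift₂ : ∀ j : Fin d, ∑' x : Site d, (1 - Real.cos (kdot m x)) * |P (x + Pi.single j 1)| ≤
      2 * B + 2 * (1 - Real.cos (m j)) * A := fun j => by
    rw [tsum_mul_shift_add (fun x => 1 - Real.cos (kdot m x)) (fun x => |P x|)]
    have hle : ∀ y : Site d, (1 - Real.cos (kdot m (y - Pi.single j 1))) * |P y| ≤
        2 * ((1 - Real.cos (kdot m y)) * |P y|) + 2 * (1 - Real.cos (m j)) * |P y| := fun y => by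
      rw [sub_eq_add_neg y, kdot_add, kdot_neg, kdot_single_one]
      have h := one_sub_cos_add_le (kdot m y) (-m j)
      rw [Real.cos_neg] at h
      nlinarith [abs_nonneg (P y)]
    have hsl : Summable fun y : Site d => (1 - Real.cos (kdot m (y - Pi.single j 1))) * |P y| :=
      Summable.of_norm_bounded (hPa.mul_left 2) fun y => by
        rw [Real.norm_eq_abs, abs_mul, abs_abs, abs_of_nonneg (sub_nonneg.2 (Real.cos_le_one _))]
        refine mul_le_mul_of_nonneg_right ?_ (abs_nonneg _)
        linarith [Real.neg_one_le_cos (kdot m (y - Pi.single j 1))]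
    calc ∑' y : Site d, (1 - Real.cos (kdot m (y - Pi.single j 1))) * |P y|
        ≤ ∑' y : Site d, (2 * ((1 - Real.cos (kdot m y)) * |P y|) + 2 * (1 - Real.cos (m j)) * |P y|) :=
          Summable.tsum_le_tsum hle hsl ((hBs.mul_left 2).add (hPa.mul_left _))
      _ = 2 * B + 2 * (1 - Real.cos (m j)) * A := by
          rw [(hBs.mul_left 2).tsum_add (hPa.mul_left _), tsum_mul_left, tsum_mul_left]
  have hgj : ∀ j : Fin d, ∑' x : Site d, (1 - Real.cos (kdot m x)) * g j x ≤
      2 * (1 - Real.cos (m j)) + 2 * (2 * B + 2 * (1 - Real.cos (m j)) * A) := by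
    intro j
    have s1 : Summable fun x : Site d => (1 - Real.cos (kdot m x)) * (if x = Pi.single j 1 then (1 : ℝ) else 0) :=
      summable_of_ne_finset_zero (s := {Pi.single j 1}) fun x hx => by
        rw [Finset.mem_singleton] at hx; simp [hx]
    have s2 : Summable fun x : Site d => (1 - Real.cos (kdot m x)) * (if x = -Pi.single j 1 then (1 : ℝ) else 0) :=
      summable_of_ne_finset_zero (s := {-Pi.single j 1}) fun x hx => by
        rw [Finset.mem_singleton] at hx; simp [hx]
    have s3 : Summable fun x : Site d => (1 - Real.cos (kdot m x)) * |P (x - Pi.single j 1)| :=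
      summable_mul_shift_sub (P := fun x => |P x|) hPa hc2 _
    have s4 : Summable fun x : Site d => (1 - Real.cos (kdot m x)) * |P (x + Pi.single j 1)| :=
      summable_mul_shift_add (P := fun x => |P x|) hPa hc2 _
    have e : (fun x : Site d => (1 - Real.cos (kdot m x)) * g j x) =
        fun x => (1 - Real.cos (kdot m x)) * (if x = Pi.single j 1 then (1 : ℝ) else 0) +
          (1 - Real.cos (kdot m x)) * (if x = -Pi.single j 1 then (1 : ℝ) else 0) +
          (1 - Real.cos (kdot m x)) * |P (x - Pi.single j 1)| +
          (1 - Real.cos (kdot m x)) * |P (x + Pi.single j 1)| := funext fun x => by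
      simp only [hg]; ring
    rw [e, ((s1.add s2).add s3).tsum_add s4, (s1.add s2).tsum_add s3, s1.tsum_add s2,
      tsum_mul_ite_eq, tsum_mul_ite_eq, kdot_single_one, kdot_neg, Real.cos_neg, kdot_single_one]
    linarith [hshift₁ j, hshift₂ j]
  -- `Σ_j (1 - cos mⱼ) = d (1 - D̂(m))`
  have hDsum : ∑ j : Fin d, (1 - Real.cos (m j)) = d * (1 - Dhat d m) := by
    rw [one_sub_Dhat]; field_simp
  -- assemble
  have hqc : 0 ≤ q * (1 / (2 * d)) := by positivity
  have hpt : ∀ x : Site d, (1 - Real.cos (kdot m x)) * (q * ((1 / (2 * d)) * ∑ j, g j x)) =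
      ∑ j, (q * (1 / (2 * d))) * ((1 - Real.cos (kdot m x)) * g j x) := fun x => by
    simp only [Finset.mul_sum]
    exact Finset.sum_congr rfl fun j _ => by ring
  have hRs : Summable fun x : Site d => (1 - Real.cos (kdot m x)) * (q * ((1 / (2 * d)) * ∑ j, g j x)) := by
    have h := summable_sum (s := (Finset.univ : Finset (Fin d)))
      (f := fun (j : Fin d) (x : Site d) => (q * (1 / (2 * d))) * ((1 - Real.cos (kdot m x)) * g j x))
      fun j _ => (hwg j).mul_left _
    exact h.congr fun x => (hpt x).symm
  calc ∑' x, (1 - Real.cos (kdot m x)) * |hvdhA q P x|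
      ≤ ∑' x, (1 - Real.cos (kdot m x)) * (q * ((1 / (2 * d)) * ∑ j, g j x)) :=
        Summable.tsum_le_tsum (fun x => mul_le_mul_of_nonneg_left (habs x) (hc0 x))
          (Summable.of_nonneg_of_le (fun x => mul_nonneg (hc0 x) (abs_nonneg _))
            (fun x => mul_le_mul_of_nonneg_left (habs x) (hc0 x)) hRs) hRs
    _ = ∑' x, ∑ j, (q * (1 / (2 * d))) * ((1 - Real.cos (kdot m x)) * g j x) := tsum_congr hpt
    _ = ∑ j, ∑' x, (q * (1 / (2 * d))) * ((1 - Real.cos (kdot m x)) * g j x) :=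
        Summable.tsum_finsetSum fun j _ => (hwg j).mul_left _
    _ = q * (1 / (2 * d)) * ∑ j, ∑' x, (1 - Real.cos (kdot m x)) * g j x := by
        rw [Finset.mul_sum]
        exact Finset.sum_congr rfl fun j _ => tsum_mul_left
    _ ≤ q * (1 / (2 * d)) * ∑ j, (2 * (1 - Real.cos (m j)) + 2 * (2 * B + 2 * (1 - Real.cos (m j)) * A)) :=
        mul_le_mul_of_nonneg_left (Finset.sum_le_sum fun j _ => hgj j) hqc
    _ = q * ((1 - Dhat d m) + 2 * B + 2 * A * (1 - Dhat d m)) := by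
        have e : ∑ j : Fin d, (2 * (1 - Real.cos (m j)) + 2 * (2 * B + 2 * (1 - Real.cos (m j)) * A)) =
            (2 + 4 * A) * ∑ j : Fin d, (1 - Real.cos (m j)) + d * (4 * B) := by
          have hconst : (d : ℝ) * (4 * B) = ∑ _j : Fin d, 4 * B := by
            rw [Finset.sum_const, Finset.card_univ, Fintype.card_fin, nsmul_eq_mul]
          rw [hconst, Finset.mul_sum, ← Finset.sum_add_distrib]
          exact Finset.sum_congr rfl fun j _ => by ring
        rw [e, hDsum]
        field_simp
        ring

end A

/-! ### The difference bounds (8.4.20)–(8.4.23) -/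

section Diff

variable {P : Site d → ℝ} (hPs : Summable P)
include hPs

/-- **(8.4.20)–(8.4.21)**: `|Π̂(l + k) - Π̂(l)| ≤ B_Π(k) + 2 √(B_Π(l)) √(B_Π(k))`, from
`Π̂(l+k) = â^{cos}(l,k) - â^{sin}(l,k)`, (8.2.29) and (8.2.30).
[cite: HeydenreichVanDerHofstad2017, (8.4.20)–(8.4.21)] -/
theorem abs_cosFT_add_sub_le (k l : Fin d → ℝ) :
    |cosFT P (l + k) - cosFT P l| ≤
      (∑' x, (1 - Real.cos (kdot k x)) * |P x|) +
        2 * Real.sqrt (∑' x, (1 - Real.cos (kdot l x)) * |P x|) *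
          Real.sqrt (∑' x, (1 - Real.cos (kdot k x)) * |P x|) := by
  set Bk := ∑' x, (1 - Real.cos (kdot k x)) * |P x| with hBk
  set Bl := ∑' x, (1 - Real.cos (kdot l x)) * |P x| with hBl
  have hBk0 : 0 ≤ Bk := tsum_nonneg fun x => mul_nonneg (sub_nonneg.2 (Real.cos_le_one _)) (abs_nonneg _)
  have hBl0 : 0 ≤ Bl := tsum_nonneg fun x => mul_nonneg (sub_nonneg.2 (Real.cos_le_one _)) (abs_nonneg _)
  have hc := cosFT_sub_add_cosFT_add hPs k l
  have hsd := cosFT_sub_sub_cosFT_add hPs k l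
  -- `Π̂(l+k) = C - S` with `C = Σ P cos cos`, `S = Σ P sin sin`
  have e : cosFT P (l + k) - cosFT P l =
      -(cosFT P l - ∑' x, P x * (Real.cos (kdot l x) * Real.cos (kdot k x))) -
        ∑' x, P x * (Real.sin (kdot l x) * Real.sin (kdot k x)) := by linarith
  rw [e]
  have h1 := abs_cosFT_sub_cosCos_le hPs k l
  have h2 : |∑' x, P x * (Real.sin (kdot l x) * Real.sin (kdot k x))| ≤ 2 * Real.sqrt Bl * Real.sqrt Bk := by
    have h := Real.abs_le_sqrt (sinSin_sq_le hPs k l)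
    rwa [show (4 : ℝ) * Bl * Bk = (2 * Real.sqrt Bl * Real.sqrt Bk) ^ 2 by
      rw [mul_pow, mul_pow, Real.sq_sqrt hBl0, Real.sq_sqrt hBk0]; ring,
      Real.sqrt_sq (by positivity)] at h
  calc |-(cosFT P l - ∑' x, P x * (Real.cos (kdot l x) * Real.cos (kdot k x))) -
        ∑' x, P x * (Real.sin (kdot l x) * Real.sin (kdot k x))|
      ≤ |-(cosFT P l - ∑' x, P x * (Real.cos (kdot l x) * Real.cos (kdot k x)))| +
        |∑' x, P x * (Real.sin (kdot l x) * Real.sin (kdot k x))| := abs_sub _ _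
    _ ≤ Bk + 2 * Real.sqrt Bl * Real.sqrt Bk := by rw [abs_neg]; exact add_le_add h1 h2

/-- **(8.4.20)–(8.4.21)** at `l - k`: `|Π̂(l - k) - Π̂(l)| ≤ B_Π(k) + 2 √(B_Π(l)) √(B_Π(k))`.
[cite: HeydenreichVanDerHofstad2017, (8.4.20)–(8.4.21)] -/
theorem abs_cosFT_sub_sub_le (k l : Fin d → ℝ) :
    |cosFT P (l - k) - cosFT P l| ≤
      (∑' x, (1 - Real.cos (kdot k x)) * |P x|) +
        2 * Real.sqrt (∑' x, (1 - Real.cos (kdot l x)) * |P x|) *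
          Real.sqrt (∑' x, (1 - Real.cos (kdot k x)) * |P x|) := by
  have h := abs_cosFT_add_sub_le hPs (-k) l
  have e1 : l + -k = l - k := by rw [sub_eq_add_neg]
  have e2 : (fun x : Site d => (1 - Real.cos (kdot (-k) x)) * |P x|) =
      fun x => (1 - Real.cos (kdot k x)) * |P x| := by
    funext x
    rw [show -k = 0 - k by simp, kdot_sub_left, kdot_zero_left, zero_sub, Real.cos_neg]
  rwa [e1, e2] at h

end Diff

/-- **(8.4.23)** for `D̂`: `|D̂(l + k) - D̂(l)| ≤ [1 - D̂(k)] + 2 √(1 - D̂(l)) √(1 - D̂(k))`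
(`D̂(l+k) - D̂(l) = -(1/d)Σⱼ [cos lⱼ (1 - cos kⱼ) + sin lⱼ sin kⱼ]`, Cauchy–Schwarz and
`sin² ≤ 2(1 - cos)`). [cite: HeydenreichVanDerHofstad2017, (8.4.23)] -/
theorem abs_Dhat_add_sub_le (k l : Fin d → ℝ) :
    |Dhat d (l + k) - Dhat d l| ≤
      (1 - Dhat d k) + 2 * Real.sqrt (1 - Dhat d l) * Real.sqrt (1 - Dhat d k) := by
  rcases Nat.eq_zero_or_pos d with hd | hd
  · subst hd
    norm_num [Dhat]
  haveI : NeZero d := ⟨by omega⟩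
  have hd' : (0 : ℝ) < d := by exact_mod_cast hd
  have hl0 := one_sub_Dhat_nonneg l
  have hk0 := one_sub_Dhat_nonneg k
  set S1 := ∑ j, Real.cos (l j) * (1 - Real.cos (k j)) with hS1
  set S2 := ∑ j, Real.sin (l j) * Real.sin (k j) with hS2
  -- the decomposition `D̂(l+k) - D̂(l) = -(S1 + S2)/d`
  have e : Dhat d (l + k) - Dhat d l = -(S1 + S2) / d := by
    rw [Dhat, Dhat, ← sub_div, ← Finset.sum_sub_distrib, hS1, hS2, ← Finset.sum_add_distrib,
      ← Finset.sum_neg_distrib]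
    congr 1
    refine Finset.sum_congr rfl fun j _ => ?_
    rw [Pi.add_apply, Real.cos_add]
    ring
  -- `Σⱼ (1 - cos mⱼ) = d (1 - D̂(m))`
  have hSk : ∑ j, (1 - Real.cos (k j)) = d * (1 - Dhat d k) := by rw [one_sub_Dhat]; field_simp
  have hSl : ∑ j, (1 - Real.cos (l j)) = d * (1 - Dhat d l) := by rw [one_sub_Dhat]; field_simp
  -- `|S1| ≤ d (1 - D̂ k)`
  have h1 : |S1| ≤ d * (1 - Dhat d k) := by
    rw [← hSk, hS1]
    refine (Finset.abs_sum_le_sum_abs _ _).trans (Finset.sum_le_sum fun j _ => ?_)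
    rw [abs_mul, abs_of_nonneg (sub_nonneg.2 (Real.cos_le_one _))]
    exact mul_le_of_le_one_left (sub_nonneg.2 (Real.cos_le_one _)) (Real.abs_cos_le_one _)
  -- `|S2| ≤ 2 d √(1 - D̂ l) √(1 - D̂ k)` (Cauchy–Schwarz, `sin² ≤ 2(1 - cos)`)
  have h2 : |S2| ≤ 2 * Real.sqrt (1 - Dhat d l) * Real.sqrt (1 - Dhat d k) * d := by
    have hcs := Finset.sum_mul_sq_le_sq_mul_sq Finset.univ (fun j => Real.sin (l j))
      (fun j => Real.sin (k j))
    have hsl : ∑ j, Real.sin (l j) ^ 2 ≤ 2 * ∑ j, (1 - Real.cos (l j)) := by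
      rw [Finset.mul_sum]
      refine Finset.sum_le_sum fun j _ => ?_
      nlinarith [Real.sin_sq_add_cos_sq (l j), Real.cos_le_one (l j), Real.neg_one_le_cos (l j)]
    have hsk : ∑ j, Real.sin (k j) ^ 2 ≤ 2 * ∑ j, (1 - Real.cos (k j)) := by
      rw [Finset.mul_sum]
      refine Finset.sum_le_sum fun j _ => ?_
      nlinarith [Real.sin_sq_add_cos_sq (k j), Real.cos_le_one (k j), Real.neg_one_le_cos (k j)]
    have hsq : S2 ^ 2 ≤ (2 * Real.sqrt (1 - Dhat d l) * Real.sqrt (1 - Dhat d k) * d) ^ 2 := by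
      calc S2 ^ 2 ≤ (∑ j, Real.sin (l j) ^ 2) * ∑ j, Real.sin (k j) ^ 2 := hcs
        _ ≤ (2 * ∑ j, (1 - Real.cos (l j))) * (2 * ∑ j, (1 - Real.cos (k j))) :=
            mul_le_mul hsl hsk (Finset.sum_nonneg fun j _ => sq_nonneg _) (by rw [hSl]; positivity)
        _ = (2 * Real.sqrt (1 - Dhat d l) * Real.sqrt (1 - Dhat d k) * d) ^ 2 := by
            rw [hSl, hSk, mul_pow, mul_pow, mul_pow, Real.sq_sqrt hl0, Real.sq_sqrt hk0]
            ring
    have h := Real.abs_le_sqrt hsq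
    rwa [Real.sqrt_sq (by positivity)] at h
  -- assemble
  rw [e, abs_div, abs_neg, abs_of_pos hd', div_le_iff₀ hd']
  calc |S1 + S2| ≤ |S1| + |S2| := abs_add_le _ _
    _ ≤ d * (1 - Dhat d k) + 2 * Real.sqrt (1 - Dhat d l) * Real.sqrt (1 - Dhat d k) * d :=
        add_le_add h1 h2
    _ = ((1 - Dhat d k) + 2 * Real.sqrt (1 - Dhat d l) * Real.sqrt (1 - Dhat d k)) * d := by ring

/-- **(8.4.23)** for `D̂` at `l - k`: `|D̂(l - k) - D̂(l)| ≤ [1 - D̂(k)] + 2 √(1 - D̂(l)) √(1 - D̂(k))`.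
[cite: HeydenreichVanDerHofstad2017, (8.4.23)] -/
theorem abs_Dhat_sub_sub_le (k l : Fin d → ℝ) :
    |Dhat d (l - k) - Dhat d l| ≤
      (1 - Dhat d k) + 2 * Real.sqrt (1 - Dhat d l) * Real.sqrt (1 - Dhat d k) := by
  have h := abs_Dhat_add_sub_le (-k) l
  rwa [← sub_eq_add_neg, Dhat_neg] at h

end Literature.Barriers.CriticalPhenomena

end
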